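import Literature.NumberTheory.Sieve.QuadraticRootsAllModuliVectors
import Literature.NumberTheory.Sieve.QuadraticRootsAllModuliKloosterman
import HarnessLib

/-!
# Hooley 1963: class sums through a fundamental domain with interval slices (the assembly)

Topic `Literature/NumberTheory/Sieve`.  Third file of the tree's proof of C. Hooley's power-saving
bound for the Weyl sums over the roots of `ν² ≡ D (mod n)` to all moduli (Acta Math. 110 (1963),
§6; the bound `∑_{n ≤ x} ρ_h(n) ≪ x^{3/4}(log x)²` as printed in Duke–Friedlander–Iwaniec, Ann. of
Math. 141 (1995), p. 424 (5)).  For ONE class of forms — the `T`-reduced forms `Q` equivalent to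
a fixed `P = [A, B, C]` with `A > 0` and non-square discriminant — the sum
`Φ(N) = ∑_{Q, 0 < A_Q ≤ N} e(h B_Q/(2A_Q))` is bounded by `O(N^{3/4}(log N)²)` as soon as the class
admits **slice data** (`Hooley1963.SliceData P h`): a subgroup `G' ≤ stab P` of automorphs with a
fundamental domain `F ⊆ ℤ²` for its action on `{P > 0}` ("only one representation from each
possible set of representations is to be included", Hooley 1967 (30)) lying in the closed upper
half-plane, meeting the axis in `{p > 0}`, whose slices `{p : (p, r) ∈ F, P(p, r) ≤ N}` (`r ≥ 1`)
are integer intervals `(a_r, b_r)` of length `≪ √N`, empty for `r > R_N ≪ √N`, on which the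
second factor of Hooley's fraction formula is `1 + O(1/r²)`.  The two instances — a half-plane for
definite `P`, a sector bounded by a Pell automorph for indefinite `P` — are constructed in
`QuadraticRootsAllModuliDefinite.lean` / `QuadraticRootsAllModuliIndefinite.lean`.  Here:

* `RootForms.signedZpowers g = {±g^k}` (the subgroups `G'` used);
* `Hooley1963.SliceData P h` (the hypothesis structure) and `SliceData.vecSet N`, the finite set of
  primitive `v ∈ F` with `0 < P(v) ≤ N`, `= {(1,0)} ∪ ⋃_{r ≤ R_N} {(p, r) : a_r < p < b_r, (p,r)=1}`
  (`mem_vecSet`);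
* `SliceData.sum_vecSet_eq` — `∑_{v ∈ vecSet N} f(vecForm P v) = m · ∑_{Q} f(Q)` with the
  multiplicity `m = #(F ∩ stab P·e₁) ≥ 1` (`QuadraticRootsAllModuliVectors.lean`);
* `SliceData.exists_norm_sum_le` — `|Φ(N)| ≤ 1 + C N^{3/4}(1 + log N)²` for `N ≥ 1` (Hooley's
  fraction formula `exp_vecForm_b_div_eq` on every slice and the moduli summation
  `Hooley1963.exists_norm_sum_sum_hooleyPhase_mul_le`), whence
  **`SliceData.isBigO_sum_class`**: `Φ(N) = O(N^{3/4} (log N)²)`.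

Everything is proved; no statement of the papers is vendored (D-0026).

## References

* C. Hooley, Acta Math. 110 (1963), §6. [cite: Hooley1963, §6]
* C. Hooley, Acta Math. 117 (1967), §6 (27)–(36). [cite: Hooley1967, §6 (27)–(36)]
* W. Duke, J. B. Friedlander, H. Iwaniec, Ann. of Math. 141 (1995), p. 424 (5).
  [cite: DukeFriedlanderIwaniec1995, p. 424 (5)]
-/

noncomputable section

namespace Literature.NumberTheory.Sieve

open scoped BigOperators MatrixGroups
open Finset Filter Asymptotics
open Literature.NumberTheory.QuadraticFields.Quadratic (BinQF)
open Literature.NumberTheory.Sieve.Iwaniec1978 (hooleyPhase norm_hooleyPhase)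

namespace RootForms

/-! ### The subgroups `{±g^k}` -/

/-- `(−γ)⁻¹ = −γ⁻¹` in `SL₂(ℤ)`. [folklore] -/
theorem neg_inv (γ : SL(2, ℤ)) : (-γ)⁻¹ = -γ⁻¹ := by
  rw [inv_eq_iff_mul_eq_one, neg_mul, mul_neg, neg_neg, mul_inv_cancel]

/-- The subgroup `{±g^k : k ∈ ℤ}` generated by an automorph `g` and `−1`. [folklore] -/
def signedZpowers (g : SL(2, ℤ)) : Subgroup SL(2, ℤ) where
  carrier := {s | ∃ k : ℤ, s = g ^ k ∨ s = -g ^ k}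
  one_mem' := ⟨0, Or.inl (zpow_zero g).symm⟩
  mul_mem' := by
    rintro s t ⟨k, hk⟩ ⟨l, hl⟩
    refine ⟨k + l, ?_⟩
    rw [zpow_add]
    rcases hk with rfl | rfl <;> rcases hl with rfl | rfl
    · exact Or.inl rfl
    · exact Or.inr (mul_neg _ _)
    · exact Or.inr (neg_mul _ _)
    · exact Or.inl (by rw [neg_mul, mul_neg, neg_neg])
  inv_mem' := by
    rintro s ⟨k, hk⟩
    refine ⟨-k, ?_⟩
    rw [zpow_neg]
    rcases hk with rfl | rfl
    · exact Or.inl rfl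
    · exact Or.inr (neg_inv _)

/-- Membership in `signedZpowers g`. [folklore] -/
theorem mem_signedZpowers {g s : SL(2, ℤ)} : s ∈ signedZpowers g ↔ ∃ k : ℤ, s = g ^ k ∨ s = -g ^ k :=
  Iff.rfl

/-- `signedZpowers g ≤ stab P` when `g` is an automorph of `P`. [folklore] -/
theorem signedZpowers_le_stab {P : BinQF} {g : SL(2, ℤ)} (hg : g ∈ stab P) : signedZpowers g ≤ stab P := by
  rintro s ⟨k, hk⟩
  have hgk : g ^ k ∈ stab P := (stab P).zpow_mem hg k
  rcases hk with rfl | rfl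
  · exact hgk
  · have : -g ^ k = (-1) * g ^ k := by rw [neg_mul, one_mul]
    rw [this]
    exact (stab P).mul_mem (neg_one_mem_stab P) hgk

end RootForms

namespace Hooley1963

open RootForms

/-! ### The weights -/

/-- The class-side weight `e(h B_Q/(2A_Q))` of a form `Q` (for `Q = [n, 2ν, ∗]` attached to a root
`ν (mod n)` of `ν² ≡ D`, this is `e(hν/n)`). [cite: Hooley1963, §6] -/
def classWeight (h : ℤ) (Q : BinQF) : ℂ :=
  Complex.exp (2 * Real.pi * Complex.I * ((h : ℂ) * (Q.b : ℂ) / (2 * (Q.a : ℂ))))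

/-- The second factor `e(−h(2Ap + Br)/(2rP(p,r)))` of Hooley's fraction formula.
[cite: Hooley1967, §6 (28)] -/
def twist (P : BinQF) (h : ℤ) (r : ℕ) (p : ℤ) : ℂ :=
  Complex.exp (2 * Real.pi * Complex.I *
    (-((h : ℂ) * ((2 * P.a * p + P.b * r : ℤ) : ℂ) / (2 * (r : ℂ) * (P.eval p r : ℂ)))))

/-- `e(t)` as `exp(2πi t)` with a real argument. [folklore] -/
theorem exp_two_pi_mul_I_ofReal (t : ℝ) :
    Complex.exp (2 * Real.pi * Complex.I * (t : ℂ)) = (Real.fourierChar t : ℂ) := by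
  rw [Real.fourierChar_apply]
  push_cast
  ring_nf

/-- `|e(h B_Q/(2A_Q))| = 1`. [folklore] -/
theorem norm_classWeight (h : ℤ) (Q : BinQF) : ‖classWeight h Q‖ = 1 := by
  have : ((h : ℂ) * (Q.b : ℂ) / (2 * (Q.a : ℂ))) = (((h : ℝ) * Q.b / (2 * Q.a) : ℝ) : ℂ) := by
    push_cast; ring
  rw [classWeight, this, exp_two_pi_mul_I_ofReal, Circle.norm_coe]

/-- The twist as `e` of a real number. [folklore] -/
theorem twist_eq_fourierChar (P : BinQF) (h : ℤ) (r : ℕ) (p : ℤ) :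
    twist P h r p = (Real.fourierChar
      (-((h : ℝ) * ((2 * P.a * p + P.b * r : ℤ) : ℝ) / (2 * (r : ℝ) * (P.eval p r : ℝ)))) : ℂ) := by
  rw [twist, ← exp_two_pi_mul_I_ofReal]
  push_cast
  ring_nf

/-! ### Slice data -/

/-- **Slice data for a class** (the hypotheses of Hooley's estimation of one class sum,
Acta Math. 117 §6 (30)–(35), for a form `P = [A, B, C]` and a frequency `h`): a subgroup `G'` of
automorphs with a fundamental domain `F ⊆ ℤ²` for its action on `{P > 0}`, lying in `{r ≥ 0}` and
meeting `{r = 0}` in `{p > 0}`; for `N, r ≥ 1` the slice `{p : (p, r) ∈ F, 0 < P(p, r) ≤ N}` is the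
integer interval `(a_{N,r}, b_{N,r})`, empty unless `r ≤ R_N`, with `R_N ≤ c₁√N`,
`b − a ≤ c₂√N`, and on it `|e(−h(2Ap + Br)/(2rP(p,r))) − 1| ≤ c₃/r²`.
[cite: Hooley1967, §6 (30)–(35)] -/
structure SliceData (P : BinQF) (h : ℤ) where
  /-- the fundamental domain -/
  F : Set (ℤ × ℤ)
  /-- the subgroup of automorphs it is a fundamental domain for -/
  G' : Subgroup SL(2, ℤ)
  /-- the last non-empty slice -/
  R : ℕ → ℕ
  /-- left end of the slice at height `r` -/
  a : ℕ → ℕ → ℤ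
  /-- right end of the slice at height `r` -/
  b : ℕ → ℕ → ℤ
  /-- `R_N ≤ c₁ √N` -/
  c₁ : ℝ
  /-- `b − a ≤ c₂ √N` -/
  c₂ : ℝ
  /-- `|twist − 1| ≤ c₃ / r²` -/
  c₃ : ℝ
  hc₁ : 0 ≤ c₁
  hc₂ : 0 ≤ c₂
  hc₃ : 0 ≤ c₃
  le_stab : G' ≤ stab P
  fund : ∀ w : ℤ × ℤ, 0 < P.eval w.1 w.2 → ∃! v, v ∈ F ∧ ∃ s ∈ G', v = vecAct s w
  snd_nonneg : ∀ v ∈ F, 0 ≤ v.2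
  fst_axis : ∀ p : ℤ, (p, (0 : ℤ)) ∈ F ↔ 0 < p
  slice : ∀ N : ℕ, 1 ≤ N → ∀ r : ℕ, 1 ≤ r → ∀ p : ℤ,
    ((p, (r : ℤ)) ∈ F ∧ 0 < P.eval p r ∧ P.eval p r ≤ N) ↔ (r ≤ R N ∧ a N r < p ∧ p < b N r)
  R_le : ∀ N : ℕ, 1 ≤ N → (R N : ℝ) ≤ c₁ * Real.sqrt N
  ab_le : ∀ N : ℕ, 1 ≤ N → ∀ r ∈ Finset.Icc 1 (R N),
    a N r ≤ b N r ∧ ((b N r - a N r : ℤ) : ℝ) ≤ c₂ * Real.sqrt N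
  twist_le : ∀ N : ℕ, 1 ≤ N → ∀ r ∈ Finset.Icc 1 (R N), ∀ p ∈ Finset.Ioo (a N r) (b N r),
    ‖twist P h r p - 1‖ ≤ c₃ / (r : ℝ) ^ 2

namespace SliceData

variable {P : BinQF} {h : ℤ} (d : SliceData P h)

/-- **The primitive vectors of the domain with `0 < P ≤ N`, as a finite set**:
`{(1, 0)} ∪ ⋃_{1 ≤ r ≤ R_N} {(p, r) : a_{N,r} < p < b_{N,r}, (p, r) = 1}` (the first piece only
when `A ≤ N`). [folklore] -/
def vecSet (N : ℕ) : Finset (ℤ × ℤ) :=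
  (if P.a ≤ N then {((1 : ℤ), (0 : ℤ))} else ∅) ∪
    (Finset.Icc 1 (d.R N)).biUnion (fun r : ℕ =>
      ((Finset.Ioo (d.a N r) (d.b N r)).filter (fun p : ℤ => Int.gcd p r = 1)).image
        (fun p : ℤ => (p, (r : ℤ))))

/-- `P(1, 0) = A`. [folklore] -/
theorem eval_one_zero (P : BinQF) : P.eval 1 0 = P.a := by
  simp [BinQF.eval]

/-- **Membership in `vecSet`**: for `N ≥ 1`, `v ∈ vecSet N` iff `v ∈ F` is primitive with
`0 < P(v) ≤ N`. [folklore] -/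
theorem mem_vecSet (hA : 0 < P.a) {N : ℕ} (hN : 1 ≤ N) (v : ℤ × ℤ) :
    v ∈ d.vecSet N ↔ v ∈ d.F ∧ Int.gcd v.1 v.2 = 1 ∧ 0 < P.eval v.1 v.2 ∧ P.eval v.1 v.2 ≤ N := by
  simp only [vecSet, Finset.mem_union, Finset.mem_biUnion, Finset.mem_image, Finset.mem_filter,
    Finset.mem_Ioo, Finset.mem_Icc]
  constructor
  · rintro (h1 | ⟨r, ⟨hr1, hrR⟩, p, ⟨⟨hap, hpb⟩, hg⟩, rfl⟩)
    · split_ifs at h1 with hAN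
      · rw [Finset.mem_singleton] at h1
        subst h1
        refine ⟨(d.fst_axis 1).2 one_pos, by simp, ?_, ?_⟩
        · rw [eval_one_zero]; exact hA
        · rw [eval_one_zero]; exact hAN
      · exact absurd h1 (Finset.notMem_empty _)
    · obtain ⟨hF, hP0, hPN⟩ := (d.slice N hN r hr1 p).2 ⟨hrR, hap, hpb⟩
      exact ⟨hF, hg, hP0, hPN⟩
  · rintro ⟨hF, hg, hP0, hPN⟩
    obtain ⟨p, r⟩ := v
    have hr0 : 0 ≤ r := d.snd_nonneg _ hF
    obtain ⟨n, rfl⟩ : ∃ n : ℕ, r = n := ⟨r.toNat, (Int.toNat_of_nonneg hr0).symm⟩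
    rcases Nat.eq_zero_or_pos n with hn | hn
    · subst hn
      left
      have hp : p = 1 := by
        have h1 : Int.gcd p ((0 : ℕ) : ℤ) = p.natAbs := by simp
        rw [h1] at hg
        have hp0 : 0 < p := (d.fst_axis p).1 (by simpa using hF)
        omega
      subst hp
      simp only [Nat.cast_zero, eval_one_zero] at hPN
      rw [if_pos hPN]
      simp
    · right
      obtain ⟨hnR, hap, hpb⟩ := (d.slice N hN n hn p).1 ⟨hF, hP0, hPN⟩
      exact ⟨n, ⟨hn, hnR⟩, p, ⟨⟨hap, hpb⟩, hg⟩, rfl⟩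

open Classical in
/-- The reference piece `F ∩ stab P · e₁` (the orbit of `e₁ = (1, 0)`, `P(e₁) = A`).
[folklore] -/
def multSet : Finset (ℤ × ℤ) :=
  (d.vecSet P.a.toNat).filter (fun v => ∃ γ ∈ stab P, v = vecAct γ ((1 : ℤ), (0 : ℤ)))

/-- **The multiplicity** `m = #(F ∩ stab P · e₁)` with which every class is counted through `F`.
[folklore] -/
def mult : ℕ := d.multSet.card

/-- Membership in the reference piece. [folklore] -/
theorem mem_multSet (hA : 0 < P.a) (v : ℤ × ℤ) :
    v ∈ d.multSet ↔ v ∈ d.F ∧ ∃ γ ∈ stab P, v = vecAct γ ((1 : ℤ), (0 : ℤ)) := by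
  classical
  have hN : 1 ≤ P.a.toNat := by omega
  have hAcast : ((P.a.toNat : ℕ) : ℤ) = P.a := Int.toNat_of_nonneg hA.le
  rw [multSet, Finset.mem_filter, d.mem_vecSet hA hN]
  constructor
  · rintro ⟨⟨hF, -, -, -⟩, hγ⟩
    exact ⟨hF, hγ⟩
  · rintro ⟨hF, γ, hγ, rfl⟩
    refine ⟨⟨hF, gcd_vecAct_eq_one γ (by simp), ?_, ?_⟩, γ, hγ, rfl⟩
    · rw [eval_vecAct_of_mem_stab hγ, eval_one_zero]; exact hA
    · rw [eval_vecAct_of_mem_stab hγ, eval_one_zero, hAcast]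

/-- `m ≥ 1` (`e₁` itself lies in `F`). [folklore] -/
theorem one_le_mult (hA : 0 < P.a) : 1 ≤ d.mult := by
  rw [mult, Nat.one_le_iff_ne_zero, Ne, Finset.card_eq_zero, ← Ne, ← Finset.nonempty_iff_ne_empty]
  exact ⟨(1, 0), (d.mem_multSet hA _).2 ⟨(d.fst_axis 1).2 one_pos, 1, (stab P).one_mem, by simp⟩⟩

/-- **Every orbit is counted `m` times**: for `N ≥ 1` and primitive `w` with `0 < P(w) ≤ N`,
`#(vecSet N ∩ stab P · w) = m`. [folklore] -/
theorem card_orbit_eq (hA : 0 < P.a) (hΔ : ¬ IsSquare P.disc) {N : ℕ} (hN : 1 ≤ N) {w : ℤ × ℤ}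
    (hw : Int.gcd w.1 w.2 = 1) (hPw : 0 < P.eval w.1 w.2) (hPwN : P.eval w.1 w.2 ≤ N)
    (T : Finset (ℤ × ℤ)) (hT : ∀ v, v ∈ T ↔ v ∈ d.vecSet N ∧ ∃ γ ∈ stab P, v = vecAct γ w) :
    T.card = d.mult := by
  refine card_orbit_inter_eq hΔ d.le_stab d.fund hw (w' := ((1 : ℤ), (0 : ℤ))) (by simp) hPw
    (by rw [eval_one_zero]; exact hA) (T := T) (T' := d.multSet) (fun v => ?_) (d.mem_multSet hA)
  rw [hT, d.mem_vecSet hA hN]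
  constructor
  · rintro ⟨⟨hF, -, -, -⟩, hγ⟩
    exact ⟨hF, hγ⟩
  · rintro ⟨hF, γ, hγ, rfl⟩
    refine ⟨⟨hF, gcd_vecAct_eq_one γ hw, ?_, ?_⟩, γ, hγ, rfl⟩
    · rw [eval_vecAct_of_mem_stab hγ]; exact hPw
    · rw [eval_vecAct_of_mem_stab hγ]; exact hPwN

/-- **The class sum as a sum over `vecSet`**: for `N ≥ 1` and `S` the `T`-reduced forms of the
class of `P` with `0 < A_Q ≤ N`, `∑_{v ∈ vecSet N} f(vecForm P v) = m ∑_{Q ∈ S} f(Q)`.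
[cite: Hooley1967, §6 (30)] -/
theorem sum_vecSet_eq (hA : 0 < P.a) (hΔ : ¬ IsSquare P.disc) {N : ℕ} (hN : 1 ≤ N)
    {S : Finset BinQF}
    (hS : ∀ Q, Q ∈ S ↔ (∃ ξ : SL(2, ℤ), Q = smul P ξ) ∧ IsTReduced Q ∧ 0 < Q.a ∧ Q.a ≤ N)
    (f : BinQF → ℂ) :
    ∑ v ∈ d.vecSet N, f (vecForm P v) = (d.mult : ℂ) * ∑ Q ∈ S, f Q :=
  sum_vecForm_eq_card_mul_sum hΔ hS (d.mem_vecSet hA hN)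
    (fun _ hw hPw hPwN T hT => d.card_orbit_eq hA hΔ hN hw hPw hPwN T hT) f

/-- **The sum over `vecSet` slice by slice**:
`∑_{v ∈ vecSet N} g(v) = [A ≤ N] g(1,0) + ∑_{r ≤ R_N} ∑_{a < p < b, (p,r)=1} g(p, r)`. [folklore] -/
theorem sum_vecSet_eq_sum_slices (N : ℕ) (g : ℤ × ℤ → ℂ) :
    ∑ v ∈ d.vecSet N, g v =
      (if P.a ≤ N then g (1, 0) else 0) +
        ∑ r ∈ Finset.Icc 1 (d.R N),
          ∑ p ∈ (Finset.Ioo (d.a N r) (d.b N r)).filter (fun p : ℤ => Int.gcd p r = 1),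
            g (p, (r : ℤ)) := by
  rw [vecSet, Finset.sum_union]
  · congr 1
    · split_ifs <;> simp
    · rw [Finset.sum_biUnion]
      · refine Finset.sum_congr rfl fun r _ => ?_
        rw [Finset.sum_image]
        intro x _ y _ hxy
        exact congrArg Prod.fst hxy
      · intro r hr r' hr' hne
        simp only [Finset.coe_Icc, Set.mem_Icc] at hr hr'
        rw [Function.onFun, Finset.disjoint_left]
        intro v hv hv'
        simp only [Finset.mem_image] at hv hv'
        obtain ⟨p, -, rfl⟩ := hv
        obtain ⟨p', -, h'⟩ := hv'
        have := congrArg Prod.snd h'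
        simp only at this
        exact hne (by exact_mod_cast this.symm)
  · rw [Finset.disjoint_left]
    intro v hv hv'
    split_ifs at hv with hAN
    · rw [Finset.mem_singleton] at hv
      subst hv
      simp only [Finset.mem_biUnion, Finset.mem_Icc, Finset.mem_image] at hv'
      obtain ⟨r, ⟨hr1, -⟩, p, -, h⟩ := hv'
      have := congrArg Prod.snd h
      simp only at this
      omega
    · exact absurd hv (Finset.notMem_empty _)

/-- **Hooley's bound for one class from slice data**: there is `C ≥ 0` with
`|∑_{Q ∈ S} e(h B_Q/(2A_Q))| ≤ 1 + C N^{3/4} (1 + log N)²` for all `N ≥ 1`, `S` the `T`-reduced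
forms of the class of `P` with `0 < A_Q ≤ N` (`A > 0`, non-square discriminant, `h ≠ 0`).
On each slice `r ≥ 1` the weight is `e(h p̄/r) · twist` by Hooley's fraction formula, and the
moduli summation `exists_norm_sum_sum_hooleyPhase_mul_le` applies; the axis contributes at most
one term. [cite: Hooley1967, §6 (30)–(36)] -/
theorem exists_norm_sum_le (d : SliceData P h) (hA : 0 < P.a) (hΔ : ¬ IsSquare P.disc) (hh : h ≠ 0) :
    ∃ C : ℝ, 0 ≤ C ∧ ∀ N : ℕ, 1 ≤ N → ∀ S : Finset BinQF,
      (∀ Q, Q ∈ S ↔ (∃ ξ : SL(2, ℤ), Q = smul P ξ) ∧ IsTReduced Q ∧ 0 < Q.a ∧ Q.a ≤ N) →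
        ‖∑ Q ∈ S, classWeight h Q‖ ≤ 1 + C * ((N : ℝ) ^ (3 / 4 : ℝ) * (1 + Real.log N) ^ 2) := by
  obtain ⟨C, hC0, hC⟩ := exists_norm_sum_sum_hooleyPhase_mul_le hh d.hc₁ d.hc₂ d.hc₃
  refine ⟨C, hC0, fun N hN S hS => ?_⟩
  have hmul := d.sum_vecSet_eq hA hΔ hN hS (classWeight h)
  rw [d.sum_vecSet_eq_sum_slices N] at hmul
  -- Hooley's fraction formula on every slice
  have hslices : ∑ r ∈ Finset.Icc 1 (d.R N),
      ∑ p ∈ (Finset.Ioo (d.a N r) (d.b N r)).filter (fun p : ℤ => Int.gcd p r = 1),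
        classWeight h (vecForm P (p, (r : ℤ))) =
      ∑ r ∈ Finset.Icc 1 (d.R N),
        ∑ p ∈ (Finset.Ioo (d.a N r) (d.b N r)).filter (fun p : ℤ => Int.gcd p r = 1),
          hooleyPhase h r p * twist P h r p := by
    refine Finset.sum_congr rfl fun r hr => Finset.sum_congr rfl fun p hp => ?_
    obtain ⟨hr1, hrR⟩ := Finset.mem_Icc.1 hr
    obtain ⟨hp', hg⟩ := Finset.mem_filter.1 hp
    obtain ⟨hap, hpb⟩ := Finset.mem_Ioo.1 hp'
    obtain ⟨-, hP0, -⟩ := (d.slice N hN r hr1 p).2 ⟨hrR, hap, hpb⟩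
    have h := exp_vecForm_b_div_eq (P := P) hg (by exact_mod_cast hr1) hP0.ne' h
    rw [Int.toNat_natCast] at h
    exact h
  rw [hslices] at hmul
  -- the bound for `m · Φ(N)`
  have hmain := hC N (d.R N) (d.a N) (d.b N) (fun r p => twist P h r p) hN (d.R_le N hN)
    (d.ab_le N hN) (d.twist_le N hN)
  have haxis : ‖(if P.a ≤ N then classWeight h (vecForm P (1, 0)) else 0)‖ ≤ 1 := by
    split_ifs
    · rw [norm_classWeight]
    · simp
  have hmΦ : ‖(d.mult : ℂ) * ∑ Q ∈ S, classWeight h Q‖ ≤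
      1 + C * ((N : ℝ) ^ (3 / 4 : ℝ) * (1 + Real.log N) ^ 2) := by
    rw [← hmul]
    exact (norm_add_le _ _).trans (add_le_add haxis hmain)
  -- divide by `m ≥ 1`
  have hm1 : (1 : ℝ) ≤ d.mult := by exact_mod_cast d.one_le_mult hA
  rw [norm_mul, Complex.norm_natCast] at hmΦ
  have h0 : 0 ≤ ‖∑ Q ∈ S, classWeight h Q‖ := norm_nonneg _
  nlinarith

/-- **Hooley's power saving for one class** (from slice data): for `A > 0`, non-square
discriminant and `h ≠ 0`, `∑_{Q T-reduced ∼ P, 0 < A_Q ≤ N} e(h B_Q/(2A_Q)) = O(N^{3/4}(log N)²)`.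
[cite: Hooley1963, §6] -/
theorem isBigO_sum_class (d : SliceData P h) (hA : 0 < P.a) (hΔ : ¬ IsSquare P.disc) (hh : h ≠ 0)
    (S : ℕ → Finset BinQF)
    (hS : ∀ N Q, Q ∈ S N ↔ (∃ ξ : SL(2, ℤ), Q = smul P ξ) ∧ IsTReduced Q ∧ 0 < Q.a ∧ Q.a ≤ N) :
    (fun N : ℕ => ∑ Q ∈ S N, classWeight h Q) =O[atTop]
      fun N : ℕ => (N : ℝ) ^ (3 / 4 : ℝ) * Real.log N ^ 2 := by
  obtain ⟨C, hC0, hC⟩ := d.exists_norm_sum_le hA hΔ hh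
  refine IsBigO.of_bound (1 + 4 * C) ?_
  filter_upwards [eventually_ge_atTop 3] with N hN
  have hN1 : 1 ≤ N := by omega
  have hNr : (3 : ℝ) ≤ N := by exact_mod_cast hN
  have hlog : 1 ≤ Real.log N := by
    rw [← Real.log_exp 1]
    refine Real.log_le_log (Real.exp_pos 1) ?_
    have := Real.exp_one_lt_d9
    linarith
  have hpow : 1 ≤ (N : ℝ) ^ (3 / 4 : ℝ) := Real.one_le_rpow (by linarith) (by norm_num)
  have hmain := hC N hN1 (S N) (hS N)
  rw [Real.norm_of_nonneg (by positivity)]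
  have h1 : (1 + Real.log N) ^ 2 ≤ 4 * Real.log N ^ 2 := by nlinarith
  have h2 : 1 ≤ (N : ℝ) ^ (3 / 4 : ℝ) * Real.log N ^ 2 := by nlinarith
  calc ‖∑ Q ∈ S N, classWeight h Q‖ ≤ 1 + C * ((N : ℝ) ^ (3 / 4 : ℝ) * (1 + Real.log N) ^ 2) := hmain
    _ ≤ (N : ℝ) ^ (3 / 4 : ℝ) * Real.log N ^ 2 + C * ((N : ℝ) ^ (3 / 4 : ℝ) * (4 * Real.log N ^ 2)) := by
        gcongr
    _ = (1 + 4 * C) * ((N : ℝ) ^ (3 / 4 : ℝ) * Real.log N ^ 2) := by ring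

end SliceData

end Hooley1963

end Literature.NumberTheory.Sieve

end
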